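import Literature.MathematicalPhysics.QuantumFieldTheory.Balaban1983to89.Beta.WilsonWardJets2

/-!
# The BACKGROUND-gauge Ward identity of the Wilson plaquette jets at order `(W², B¹)`, ENTRYWISE; part 2: the gauge parameter at the
# corners `x₃`, `x₄`

Companion of `Summits/QuantumFields/BalabanUV/Beta/WilsonBackgroundWard22.lean` — READ ITS HEADER for the honest framing, the setting, the
identity (bgW₂) `4·Pol_B F_{2,2}(h ; B, W₀λ) + 4·Pol_W F_{2,1}(h, ad_λ h ; B) + 2·F_{2,1}(h ; [λ(b₋)+λ(b₊), B]) = 0`, the method (an3's integer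
closed forms + commutator-sum certificates from the archived exact engine, kernel-re-verified by `noncomm_ring`) and what is NOT done.  This
file holds the eight entries `bgWard22_x{k}_b{m}`, `k ∈ {3, 4}`, `m ∈ {1, 2, 3, 4}` (split only for the 400-line limit; the two files are
independent modules).  At `x₃` no bond of the word STARTS, so the adjoint group is absent there; the entries `(x₃, b₁)` and `(x₃, b₄)` (the
corner touches neither bond) say that the mixed background Hessian entry `Pol_B F_{2,2}(h ; b·e_m, W₀λ)` vanishes by itself under the trace.

NOT IN PRINT; OUR BOOKKEEPING (cell `pub-balaban`, β sub-cell, D1 formalisation swarm seat `b2b-balaban-beta-d1-formalise-leaf-09`, gen 3).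
HONEST FRAMING (cell contract, verbatim): «discharging `BetaPertH` makes Bałaban's UV stability UNCONDITIONAL — a real constructive-QFT
result; it is NOT the continuum limit and NOT the Clay problem.»  HONEST DEPENDENCY (verbatim): «continuum YM on T⁴ ⇐ BetaPertH ∧ nine
spine estimates (0/9 proved); BetaPertH ⇐ (D1) ∧ (D4) ∧ CAP+tail; G-an2-4 gates asym, D1 and NE2/3/4.»  THIS FILE DISCHARGES NOTHING of the
wall; [folklore] multilinear algebra in an arbitrary normed algebra; no binder of (D1) instantiated; not summit progress, not continuum, not
Clay.  ABSOLUTE RULE (cell, verbatim): «No internally-minted statement may enter as a cited fact. Every hypothesis is either kernel-proved in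
this package or a verbatim quotation of a PUBLISHED theorem with page reference. The manuscript(s) under audit are NOT citable for their own
disputed steps — they are the thing under adjudication; programme-internal (2001/route/tribunal) claims are never citable.»  Nothing is
cited; no `def` at all; every statement is kernel-proved from an3's `Beta.WilsonWardJets2` / `Beta.WilsonVertex2` / `Beta.WilsonVertex` /
`Beta.WilsonWardJets` BY NAME.
-/

namespace Summit.QuantumFields.BalabanUV.Beta.WilsonBackgroundWard22Upper

open Literature.MathematicalPhysics.QuantumFieldTheory.Balaban1983to89.Beta.TransportVertices
open Literature.MathematicalPhysics.QuantumFieldTheory.Balaban1983to89.Beta.WilsonVertex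
open Literature.MathematicalPhysics.QuantumFieldTheory.Balaban1983to89.Beta.WilsonVertex2
open Literature.MathematicalPhysics.QuantumFieldTheory.Balaban1983to89.Beta.SpinTable (br)
open Literature.MathematicalPhysics.QuantumFieldTheory.Balaban1983to89.Beta.WilsonWardJets
  (csum csum_nil csum_cons trace_eq_zero_of_eq_csum)
open Literature.MathematicalPhysics.QuantumFieldTheory.Balaban1983to89.Beta.WilsonWardJets2
  (two_smul_twist₂_plaq four_smul_trace_P22 four_smul_trace_P21)

/-! ## The entries `bgWard22_x{k}_b{m}`, `k ∈ {3,4}` (`λ = l` at the corner `x_k`, background `b` on the bond `b_m`, fluctuation `h₁ … h₄` arbitrary) -/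
section Entries

variable (𝕜 : Type*) [RCLike 𝕜] {𝔸 : Type*} [NormedRing 𝔸] [NormedAlgebra 𝕜 𝔸]
variable {V : Type*} [AddCommGroup V] [Module 𝕜 V]
variable (τ : 𝔸 →ₗ[𝕜] V) (h₁ h₂ h₃ h₄ b l : 𝔸)

set_option maxHeartbeats 2000000 in
/-- **Entry `(x_3, b_1)`** of the order-`(W², B¹)` BACKGROUND-gauge Ward identity: `λ = l` at `x₃` (end of `b₂` and of `b₃`; no bond starts there, so the adjoint group is absent) only, the background `B = b` on `b₁ : x₁ → x₂` only, the fluctuation `h = (h₁, h₂, h₃, h₄)` arbitrary; groups present: `F_{2,2}` (polarised in the background against `W₀λ`) (no rotated-letter term: the corner does not touch the bond).  Collected difference 0 monomials, certificate 0. [folklore] -/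
theorem bgWard22_x3_b1 (hτ : ∀ a b : 𝔸, τ (a * b) = τ (b * a)) :
    (4 : 𝕜) • τ (P22 𝕜 (plaq h₁ h₂ h₃ h₄ b (-l) (-l) 0))
      - (4 : 𝕜) • τ (P22 𝕜 (plaq h₁ h₂ h₃ h₄ b 0 0 0))
      - (4 : 𝕜) • τ (P22 𝕜 (plaq h₁ h₂ h₃ h₄ 0 (-l) (-l) 0))
      = 0 := by
  simp only [four_smul_trace_P22 𝕜 τ hτ, two_smul_twist₂_plaq, two_smul_qtwistAux, wpart_plaq,
    bpart_plaq, twist_plaq, sum_four_signed, two_smul_quad, commSum_four]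
  simp only [plaq, ctwistAux_consW, ctwistAux_consB, ctwistAux_nil, twistAux_consW, twistAux_consB, twistAux_nil, wpart_consW,
    wpart_consB, wpart_nil, List.sum_cons, List.sum_nil]
  simp only [← map_add, ← map_sub]
  refine trace_eq_zero_of_eq_csum 𝕜 τ hτ [] ?_
  simp only [csum_nil, br]
  noncomm_ring

set_option maxHeartbeats 2000000 in
/-- **Entry `(x_3, b_2)`** of the order-`(W², B¹)` BACKGROUND-gauge Ward identity: `λ = l` at `x₃` (end of `b₂` and of `b₃`; no bond starts there, so the adjoint group is absent) only, the background `B = b` on `b₂ : x₂ → x₃` only, the fluctuation `h = (h₁, h₂, h₃, h₄)` arbitrary; groups present: `F_{2,2}` (polarised in the background against `W₀λ`), and the ROTATED-LETTER term `2·F_{2,1}(h; [λ(b₋)+λ(b₊), B])` (the corner touches the bond).  Collected difference 48 monomials, certificate 48. [folklore] -/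
theorem bgWard22_x3_b2 (hτ : ∀ a b : 𝔸, τ (a * b) = τ (b * a)) :
    (4 : 𝕜) • τ (P22 𝕜 (plaq h₁ h₂ h₃ h₄ 0 (b - l) (-l) 0))
      - (4 : 𝕜) • τ (P22 𝕜 (plaq h₁ h₂ h₃ h₄ 0 b 0 0))
      - (4 : 𝕜) • τ (P22 𝕜 (plaq h₁ h₂ h₃ h₄ 0 (-l) (-l) 0))
      + (2 : 𝕜) • τ (P21 𝕜 (plaq h₁ h₂ h₃ h₄ 0 (l * b - b * l) 0 0))
      = 0 := by
  simp only [four_smul_trace_P22 𝕜 τ hτ, two_smul_trace_P21 𝕜 τ hτ, two_smul_twist₂_plaq, two_smul_qtwistAux,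
    wpart_plaq, bpart_plaq, twist_plaq, sum_four_signed, two_smul_quad, commSum_four]
  simp only [plaq, ctwistAux_consW, ctwistAux_consB, ctwistAux_nil, twistAux_consW, twistAux_consB, twistAux_nil, wpart_consW,
    wpart_consB, wpart_nil, List.sum_cons, List.sum_nil]
  simp only [two_smul, ← map_add, ← map_sub]
  refine trace_eq_zero_of_eq_csum 𝕜 τ hτ
    [(h₁,
      (h₃ * l * b) + (h₄ * l * b) + (l * b * h₂) - (h₂ * l * b) - (l * b * h₃) - (l * b * h₄)),
    (h₂,
      (h₁ * l * b) + (h₃ * l * b) + (h₄ * l * b) - (l * b * h₁) - (l * b * h₃) - (l * b * h₄)),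
    (h₃,
      (l * b * h₁) + (l * b * h₂) + (l * b * h₄) - (h₁ * l * b) - (h₂ * l * b) - (h₄ * l * b)),
    (h₄,
      (h₃ * l * b) + (l * b * h₁) + (l * b * h₂) - (h₁ * l * b) - (h₂ * l * b) - (l * b * h₃)),
    (b,
      (l * h₁ * h₃) + (l * h₁ * h₄) + (l * h₂ * h₁) + (l * h₂ * h₃) + (l * h₂ * h₄) + (l * h₄ * h₃) - (l * h₁ * h₂) - (l * h₃ * h₁) - (l * h₃ * h₂) - (l * h₃ * h₄) - (l * h₄ * h₁) - (l * h₄ * h₂)),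
    (l,
      (h₁ * h₃ * b) + (h₁ * h₄ * b) + (h₂ * h₁ * b) + (h₂ * h₃ * b) + (h₂ * h₄ * b) + (h₄ * h₃ * b) - (h₁ * h₂ * b) - (h₃ * h₁ * b) - (h₃ * h₂ * b) - (h₃ * h₄ * b) - (h₄ * h₁ * b) - (h₄ * h₂ * b))] ?_
  simp only [csum_cons, csum_nil, br]
  noncomm_ring

set_option maxHeartbeats 2000000 in
/-- **Entry `(x_3, b_3)`** of the order-`(W², B¹)` BACKGROUND-gauge Ward identity: `λ = l` at `x₃` (end of `b₂` and of `b₃`; no bond starts there, so the adjoint group is absent) only, the background `B = b` on `b₃ : x₄ → x₃` only, the fluctuation `h = (h₁, h₂, h₃, h₄)` arbitrary; groups present: `F_{2,2}` (polarised in the background against `W₀λ`), and the ROTATED-LETTER term `2·F_{2,1}(h; [λ(b₋)+λ(b₊), B])` (the corner touches the bond).  Collected difference 48 monomials, certificate 48. [folklore] -/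
theorem bgWard22_x3_b3 (hτ : ∀ a b : 𝔸, τ (a * b) = τ (b * a)) :
    (4 : 𝕜) • τ (P22 𝕜 (plaq h₁ h₂ h₃ h₄ 0 (-l) (b - l) 0))
      - (4 : 𝕜) • τ (P22 𝕜 (plaq h₁ h₂ h₃ h₄ 0 0 b 0))
      - (4 : 𝕜) • τ (P22 𝕜 (plaq h₁ h₂ h₃ h₄ 0 (-l) (-l) 0))
      + (2 : 𝕜) • τ (P21 𝕜 (plaq h₁ h₂ h₃ h₄ 0 0 (l * b - b * l) 0))
      = 0 := by
  simp only [four_smul_trace_P22 𝕜 τ hτ, two_smul_trace_P21 𝕜 τ hτ, two_smul_twist₂_plaq, two_smul_qtwistAux,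
    wpart_plaq, bpart_plaq, twist_plaq, sum_four_signed, two_smul_quad, commSum_four]
  simp only [plaq, ctwistAux_consW, ctwistAux_consB, ctwistAux_nil, twistAux_consW, twistAux_consB, twistAux_nil, wpart_consW,
    wpart_consB, wpart_nil, List.sum_cons, List.sum_nil]
  simp only [two_smul, ← map_add, ← map_sub]
  refine trace_eq_zero_of_eq_csum 𝕜 τ hτ
    [(h₁,
      (h₂ * l * b) + (l * b * h₃) + (l * b * h₄) - (h₃ * l * b) - (h₄ * l * b) - (l * b * h₂)),
    (h₂,
      (l * b * h₁) + (l * b * h₃) + (l * b * h₄) - (h₁ * l * b) - (h₃ * l * b) - (h₄ * l * b)),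
    (h₃,
      (h₁ * l * b) + (h₂ * l * b) + (h₄ * l * b) - (l * b * h₁) - (l * b * h₂) - (l * b * h₄)),
    (h₄,
      (h₁ * l * b) + (h₂ * l * b) + (l * b * h₃) - (h₃ * l * b) - (l * b * h₁) - (l * b * h₂)),
    (b,
      (l * h₁ * h₂) + (l * h₃ * h₁) + (l * h₃ * h₂) + (l * h₃ * h₄) + (l * h₄ * h₁) + (l * h₄ * h₂) - (l * h₁ * h₃) - (l * h₁ * h₄) - (l * h₂ * h₁) - (l * h₂ * h₃) - (l * h₂ * h₄) - (l * h₄ * h₃)),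
    (l,
      (h₁ * h₂ * b) + (h₃ * h₁ * b) + (h₃ * h₂ * b) + (h₃ * h₄ * b) + (h₄ * h₁ * b) + (h₄ * h₂ * b) - (h₁ * h₃ * b) - (h₁ * h₄ * b) - (h₂ * h₁ * b) - (h₂ * h₃ * b) - (h₂ * h₄ * b) - (h₄ * h₃ * b))] ?_
  simp only [csum_cons, csum_nil, br]
  noncomm_ring

set_option maxHeartbeats 2000000 in
/-- **Entry `(x_3, b_4)`** of the order-`(W², B¹)` BACKGROUND-gauge Ward identity: `λ = l` at `x₃` (end of `b₂` and of `b₃`; no bond starts there, so the adjoint group is absent) only, the background `B = b` on `b₄ : x₁ → x₄` only, the fluctuation `h = (h₁, h₂, h₃, h₄)` arbitrary; groups present: `F_{2,2}` (polarised in the background against `W₀λ`) (no rotated-letter term: the corner does not touch the bond).  Collected difference 0 monomials, certificate 0. [folklore] -/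
theorem bgWard22_x3_b4 (hτ : ∀ a b : 𝔸, τ (a * b) = τ (b * a)) :
    (4 : 𝕜) • τ (P22 𝕜 (plaq h₁ h₂ h₃ h₄ 0 (-l) (-l) b))
      - (4 : 𝕜) • τ (P22 𝕜 (plaq h₁ h₂ h₃ h₄ 0 0 0 b))
      - (4 : 𝕜) • τ (P22 𝕜 (plaq h₁ h₂ h₃ h₄ 0 (-l) (-l) 0))
      = 0 := by
  simp only [four_smul_trace_P22 𝕜 τ hτ, two_smul_twist₂_plaq, two_smul_qtwistAux, wpart_plaq,
    bpart_plaq, twist_plaq, sum_four_signed, two_smul_quad, commSum_four]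
  simp only [plaq, ctwistAux_consW, ctwistAux_consB, ctwistAux_nil, twistAux_consW, twistAux_consB, twistAux_nil, wpart_consW,
    wpart_consB, wpart_nil, List.sum_cons, List.sum_nil]
  simp only [← map_add, ← map_sub]
  refine trace_eq_zero_of_eq_csum 𝕜 τ hτ [] ?_
  simp only [csum_nil, br]
  noncomm_ring

set_option maxHeartbeats 2000000 in
/-- **Entry `(x_4, b_1)`** of the order-`(W², B¹)` BACKGROUND-gauge Ward identity: `λ = l` at `x₄` (start of `b₃`, end of `b₄`) only, the background `B = b` on `b₁ : x₁ → x₂` only, the fluctuation `h = (h₁, h₂, h₃, h₄)` arbitrary; groups present: `F_{2,2}` (polarised in the background against `W₀λ`), `F_{2,1}` (polarised in the fluctuation against `ad_λ h`) (no rotated-letter term: the corner does not touch the bond).  Collected difference 36 monomials, certificate 28. [folklore] -/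
theorem bgWard22_x4_b1 (hτ : ∀ a b : 𝔸, τ (a * b) = τ (b * a)) :
    (4 : 𝕜) • τ (P22 𝕜 (plaq h₁ h₂ h₃ h₄ b 0 l (-l)))
      - (4 : 𝕜) • τ (P22 𝕜 (plaq h₁ h₂ h₃ h₄ b 0 0 0))
      - (4 : 𝕜) • τ (P22 𝕜 (plaq h₁ h₂ h₃ h₄ 0 0 l (-l)))
      + ((4 : 𝕜) • τ (P21 𝕜 (plaq h₁ h₂ (h₃ + l * h₃ - h₃ * l) h₄ b 0 0 0))
          - (4 : 𝕜) • τ (P21 𝕜 (plaq h₁ h₂ h₃ h₄ b 0 0 0))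
          - (4 : 𝕜) • τ (P21 𝕜 (plaq 0 0 (l * h₃ - h₃ * l) 0 b 0 0 0)))
      = 0 := by
  simp only [four_smul_trace_P22 𝕜 τ hτ, four_smul_trace_P21 𝕜 τ hτ, two_smul_twist₂_plaq, two_smul_qtwistAux,
    wpart_plaq, bpart_plaq, twist_plaq, sum_four_signed, two_smul_quad, commSum_four]
  simp only [plaq, ctwistAux_consW, ctwistAux_consB, ctwistAux_nil, twistAux_consW, twistAux_consB, twistAux_nil, wpart_consW,
    wpart_consB, wpart_nil, List.sum_cons, List.sum_nil]
  simp only [← map_add, ← map_sub]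
  refine trace_eq_zero_of_eq_csum 𝕜 τ hτ
    [(h₂,
      2 * (l * h₃ * b) - 2 * (h₃ * l * b)),
    (h₃,
      2 * (h₂ * b * l) + 2 * (h₃ * l * b) + 2 * (l * h₄ * b) - 2 * (h₃ * b * l) - 2 * (h₄ * b * l) - 2 * (l * h₂ * b)),
    (h₄,
      2 * (h₃ * l * b) - 2 * (l * h₃ * b)),
    (b,
      2 * (h₁ * h₃ * l) + 2 * (h₃ * h₃ * l) + 4 * (h₄ * h₃ * l) + 2 * (l * h₃ * h₁) + 2 * (l * h₃ * h₂) + 2 * (l * h₃ * h₄) - 2 * (h₁ * l * h₃) - 2 * (h₃ * l * h₁) - 2 * (h₃ * l * h₂) - 2 * (h₃ * l * h₃) - 2 * (h₃ * l * h₄) - 4 * (h₄ * l * h₃)),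
    (l,
      2 * (h₃ * b * h₃) + 2 * (h₃ * h₂ * b) + 2 * (h₄ * b * h₃) - 2 * (h₂ * b * h₃) - 2 * (h₃ * h₃ * b) - 2 * (h₃ * h₄ * b))] ?_
  simp only [csum_cons, csum_nil, br]
  noncomm_ring

set_option maxHeartbeats 2000000 in
/-- **Entry `(x_4, b_2)`** of the order-`(W², B¹)` BACKGROUND-gauge Ward identity: `λ = l` at `x₄` (start of `b₃`, end of `b₄`) only, the background `B = b` on `b₂ : x₂ → x₃` only, the fluctuation `h = (h₁, h₂, h₃, h₄)` arbitrary; groups present: `F_{2,2}` (polarised in the background against `W₀λ`), `F_{2,1}` (polarised in the fluctuation against `ad_λ h`) (no rotated-letter term: the corner does not touch the bond).  Collected difference 36 monomials, certificate 24. [folklore] -/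
theorem bgWard22_x4_b2 (hτ : ∀ a b : 𝔸, τ (a * b) = τ (b * a)) :
    (4 : 𝕜) • τ (P22 𝕜 (plaq h₁ h₂ h₃ h₄ 0 b l (-l)))
      - (4 : 𝕜) • τ (P22 𝕜 (plaq h₁ h₂ h₃ h₄ 0 b 0 0))
      - (4 : 𝕜) • τ (P22 𝕜 (plaq h₁ h₂ h₃ h₄ 0 0 l (-l)))
      + ((4 : 𝕜) • τ (P21 𝕜 (plaq h₁ h₂ (h₃ + l * h₃ - h₃ * l) h₄ 0 b 0 0))
          - (4 : 𝕜) • τ (P21 𝕜 (plaq h₁ h₂ h₃ h₄ 0 b 0 0))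
          - (4 : 𝕜) • τ (P21 𝕜 (plaq 0 0 (l * h₃ - h₃ * l) 0 0 b 0 0)))
      = 0 := by
  simp only [four_smul_trace_P22 𝕜 τ hτ, four_smul_trace_P21 𝕜 τ hτ, two_smul_twist₂_plaq, two_smul_qtwistAux,
    wpart_plaq, bpart_plaq, twist_plaq, sum_four_signed, two_smul_quad, commSum_four]
  simp only [plaq, ctwistAux_consW, ctwistAux_consB, ctwistAux_nil, twistAux_consW, twistAux_consB, twistAux_nil, wpart_consW,
    wpart_consB, wpart_nil, List.sum_cons, List.sum_nil]
  simp only [← map_add, ← map_sub]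
  refine trace_eq_zero_of_eq_csum 𝕜 τ hτ
    [(h₃,
      2 * (h₃ * l * b) + 2 * (l * h₄ * b) - 2 * (h₃ * b * l) - 2 * (h₄ * b * l)),
    (h₄,
      2 * (h₃ * l * b) - 2 * (l * h₃ * b)),
    (b,
      2 * (h₁ * h₃ * l) + 2 * (h₂ * h₃ * l) + 2 * (h₃ * h₃ * l) + 4 * (h₄ * h₃ * l) + 2 * (l * h₃ * h₁) + 2 * (l * h₃ * h₂) + 2 * (l * h₃ * h₄) - 2 * (h₁ * l * h₃) - 2 * (h₂ * l * h₃) - 2 * (h₃ * l * h₁) - 2 * (h₃ * l * h₂) - 2 * (h₃ * l * h₃) - 2 * (h₃ * l * h₄) - 4 * (h₄ * l * h₃)),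
    (l,
      2 * (h₃ * b * h₃) + 2 * (h₄ * b * h₃) - 2 * (h₃ * h₃ * b) - 2 * (h₃ * h₄ * b))] ?_
  simp only [csum_cons, csum_nil, br]
  noncomm_ring

set_option maxHeartbeats 2000000 in
/-- **Entry `(x_4, b_3)`** of the order-`(W², B¹)` BACKGROUND-gauge Ward identity: `λ = l` at `x₄` (start of `b₃`, end of `b₄`) only, the background `B = b` on `b₃ : x₄ → x₃` only, the fluctuation `h = (h₁, h₂, h₃, h₄)` arbitrary; groups present: `F_{2,2}` (polarised in the background against `W₀λ`), `F_{2,1}` (polarised in the fluctuation against `ad_λ h`), and the ROTATED-LETTER term `2·F_{2,1}(h; [λ(b₋)+λ(b₊), B])` (the corner touches the bond).  Collected difference 78 monomials, certificate 67. [folklore] -/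
theorem bgWard22_x4_b3 (hτ : ∀ a b : 𝔸, τ (a * b) = τ (b * a)) :
    (4 : 𝕜) • τ (P22 𝕜 (plaq h₁ h₂ h₃ h₄ 0 0 (b + l) (-l)))
      - (4 : 𝕜) • τ (P22 𝕜 (plaq h₁ h₂ h₃ h₄ 0 0 b 0))
      - (4 : 𝕜) • τ (P22 𝕜 (plaq h₁ h₂ h₃ h₄ 0 0 l (-l)))
      + ((4 : 𝕜) • τ (P21 𝕜 (plaq h₁ h₂ (h₃ + l * h₃ - h₃ * l) h₄ 0 0 b 0))
          - (4 : 𝕜) • τ (P21 𝕜 (plaq h₁ h₂ h₃ h₄ 0 0 b 0))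
          - (4 : 𝕜) • τ (P21 𝕜 (plaq 0 0 (l * h₃ - h₃ * l) 0 0 0 b 0)))
      + (2 : 𝕜) • τ (P21 𝕜 (plaq h₁ h₂ h₃ h₄ 0 0 (l * b - b * l) 0))
      = 0 := by
  simp only [four_smul_trace_P22 𝕜 τ hτ, four_smul_trace_P21 𝕜 τ hτ, two_smul_trace_P21 𝕜 τ hτ, two_smul_twist₂_plaq,
    two_smul_qtwistAux, wpart_plaq, bpart_plaq, twist_plaq, sum_four_signed, two_smul_quad, commSum_four]
  simp only [plaq, ctwistAux_consW, ctwistAux_consB, ctwistAux_nil, twistAux_consW, twistAux_consB, twistAux_nil, wpart_consW,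
    wpart_consB, wpart_nil, List.sum_cons, List.sum_nil]
  simp only [two_smul, ← map_add, ← map_sub]
  refine trace_eq_zero_of_eq_csum 𝕜 τ hτ
    [(h₁,
      (h₂ * l * b) + (l * b * h₃) + (l * b * h₄) - (h₃ * l * b) - (h₄ * l * b) - (l * b * h₂)),
    (h₂,
      (l * b * h₁) + (l * b * h₃) + (l * b * h₄) - (h₁ * l * b) - (h₃ * l * b) - (h₄ * l * b)),
    (h₃,
      (h₁ * l * b) + (h₂ * l * b) + 2 * (h₃ * b * l) + 2 * (h₄ * b * l) + (h₄ * l * b) - 2 * (h₃ * l * b) - (l * b * h₁) - (l * b * h₂) - (l * b * h₄) - 2 * (l * h₄ * b)),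
    (h₄,
      (h₁ * l * b) + (h₂ * l * b) + (l * b * h₃) + 2 * (l * h₃ * b) - 3 * (h₃ * l * b) - (l * b * h₁) - (l * b * h₂)),
    (b,
      2 * (h₁ * l * h₃) + 2 * (h₂ * l * h₃) + 2 * (h₃ * l * h₁) + 2 * (h₃ * l * h₂) + 2 * (h₃ * l * h₃) + 2 * (h₃ * l * h₄) + 4 * (h₄ * l * h₃) + (l * h₁ * h₂) + (l * h₄ * h₁) + (l * h₄ * h₂) - 2 * (h₁ * h₃ * l) - 2 * (h₂ * h₃ * l) - 2 * (h₃ * h₃ * l) - 4 * (h₄ * h₃ * l) - (l * h₁ * h₃) - (l * h₁ * h₄) - (l * h₂ * h₁) - (l * h₂ * h₃) - (l * h₂ * h₄) - (l * h₃ * h₁) - (l * h₃ * h₂) - (l * h₃ * h₄) - (l * h₄ * h₃)),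
    (l,
      (h₁ * h₂ * b) + (h₃ * h₁ * b) + (h₃ * h₂ * b) + 2 * (h₃ * h₃ * b) + 3 * (h₃ * h₄ * b) + (h₄ * h₁ * b) + (h₄ * h₂ * b) - (h₁ * h₃ * b) - (h₁ * h₄ * b) - (h₂ * h₁ * b) - (h₂ * h₃ * b) - (h₂ * h₄ * b) - 2 * (h₃ * b * h₃) - 2 * (h₄ * b * h₃) - (h₄ * h₃ * b))] ?_
  simp only [csum_cons, csum_nil, br]
  noncomm_ring

set_option maxHeartbeats 2000000 in
/-- **Entry `(x_4, b_4)`** of the order-`(W², B¹)` BACKGROUND-gauge Ward identity: `λ = l` at `x₄` (start of `b₃`, end of `b₄`) only, the background `B = b` on `b₄ : x₁ → x₄` only, the fluctuation `h = (h₁, h₂, h₃, h₄)` arbitrary; groups present: `F_{2,2}` (polarised in the background against `W₀λ`), `F_{2,1}` (polarised in the fluctuation against `ad_λ h`), and the ROTATED-LETTER term `2·F_{2,1}(h; [λ(b₋)+λ(b₊), B])` (the corner touches the bond).  Collected difference 70 monomials, certificate 61. [folklore] -/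
theorem bgWard22_x4_b4 (hτ : ∀ a b : 𝔸, τ (a * b) = τ (b * a)) :
    (4 : 𝕜) • τ (P22 𝕜 (plaq h₁ h₂ h₃ h₄ 0 0 l (b - l)))
      - (4 : 𝕜) • τ (P22 𝕜 (plaq h₁ h₂ h₃ h₄ 0 0 0 b))
      - (4 : 𝕜) • τ (P22 𝕜 (plaq h₁ h₂ h₃ h₄ 0 0 l (-l)))
      + ((4 : 𝕜) • τ (P21 𝕜 (plaq h₁ h₂ (h₃ + l * h₃ - h₃ * l) h₄ 0 0 0 b))
          - (4 : 𝕜) • τ (P21 𝕜 (plaq h₁ h₂ h₃ h₄ 0 0 0 b))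
          - (4 : 𝕜) • τ (P21 𝕜 (plaq 0 0 (l * h₃ - h₃ * l) 0 0 0 0 b)))
      + (2 : 𝕜) • τ (P21 𝕜 (plaq h₁ h₂ h₃ h₄ 0 0 0 (l * b - b * l)))
      = 0 := by
  simp only [four_smul_trace_P22 𝕜 τ hτ, four_smul_trace_P21 𝕜 τ hτ, two_smul_trace_P21 𝕜 τ hτ, two_smul_twist₂_plaq,
    two_smul_qtwistAux, wpart_plaq, bpart_plaq, twist_plaq, sum_four_signed, two_smul_quad, commSum_four]
  simp only [plaq, ctwistAux_consW, ctwistAux_consB, ctwistAux_nil, twistAux_consW, twistAux_consB, twistAux_nil, wpart_consW,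
    wpart_consB, wpart_nil, List.sum_cons, List.sum_nil]
  simp only [two_smul, ← map_add, ← map_sub]
  refine trace_eq_zero_of_eq_csum 𝕜 τ hτ
    [(h₁,
      (h₂ * l * b) + (l * b * h₃) + (l * b * h₄) - (h₃ * l * b) - (h₄ * l * b) - (l * b * h₂)),
    (h₂,
      (l * b * h₁) + (l * b * h₃) + (l * b * h₄) - (h₁ * l * b) - (h₃ * l * b) - (h₄ * l * b)),
    (h₃,
      (h₁ * l * b) + (h₂ * l * b) + 2 * (h₄ * b * l) + (h₄ * l * b) - (l * b * h₁) - (l * b * h₂) - (l * b * h₄) - 2 * (l * h₄ * b)),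
    (h₄,
      (h₁ * l * b) + (h₂ * l * b) + (l * b * h₃) + 2 * (l * h₃ * b) - 3 * (h₃ * l * b) - (l * b * h₁) - (l * b * h₂)),
    (b,
      2 * (h₁ * l * h₃) + 2 * (h₂ * l * h₃) + 2 * (h₃ * l * h₁) + 2 * (h₃ * l * h₂) + 2 * (h₃ * l * h₄) + 4 * (h₄ * l * h₃) + (l * h₁ * h₂) + (l * h₄ * h₁) + (l * h₄ * h₂) - 2 * (h₁ * h₃ * l) - 2 * (h₂ * h₃ * l) - 4 * (h₄ * h₃ * l) - (l * h₁ * h₃) - (l * h₁ * h₄) - (l * h₂ * h₁) - (l * h₂ * h₃) - (l * h₂ * h₄) - (l * h₃ * h₁) - (l * h₃ * h₂) - (l * h₃ * h₄) - (l * h₄ * h₃)),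
    (l,
      (h₁ * h₂ * b) + (h₃ * h₁ * b) + (h₃ * h₂ * b) + 3 * (h₃ * h₄ * b) + (h₄ * h₁ * b) + (h₄ * h₂ * b) - (h₁ * h₃ * b) - (h₁ * h₄ * b) - (h₂ * h₁ * b) - (h₂ * h₃ * b) - (h₂ * h₄ * b) - 2 * (h₄ * b * h₃) - (h₄ * h₃ * b))] ?_
  simp only [csum_cons, csum_nil, br]
  noncomm_ring

end Entries

end Summit.QuantumFields.BalabanUV.Beta.WilsonBackgroundWard22Upper
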